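import Summits.CriticalPhenomena.PercolationContinuityZ3.Theorems.PercNearOneGluingNoHeavyQuantGatedSliceMixLawQMidsAbsorb
import Summits.CriticalPhenomena.PercolationContinuityZ3.Theorems.PercNearOneGluingNoHeavyQuantGatedSliceMixLawQLightIneq
import Summits.CriticalPhenomena.PercolationContinuityZ3.Theorems.PercNearOneGluingNoHeavyQuantLawDecUsageMonge
import HarnessLib

/-!
# QUANT lane R8, T-DEC, leg (III), blob case — `LawDec.GatedSliceMixLaw'`, the Q-ALONE side in REGIME R: the LIGHT-TOP cell — twin `k₁ + a ≤ t` a mid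
# (closed OR open to `k₁`), top `k₂ ≤ j` open to `k₁` and LIGHT (`t − 2k₁ < y(k₂ − k₁)`), on either side of `t` (classes `mm` and `mM`): `Q` is DEC

builds on p205010 (kernel theorem, internal audit signed; external expert review pending)

Support file (`--supports stmt-CriticalPhenomena-4575`), QUANT lane seat prim-quant-arm-1 (gen 41), rung R8 of
`run/shared/lean/prim/quant/LADDER.md`.  Theorems only, standard axioms, no sorries, no definitions.  Uses `…QRouting` (`mixLawQ_decAtT_of_routing`),
`…QMidsAbsorb`, and the scalar lemmas of `…QLightIneq`.  Memo `run/shared/lean/prim/quant/prim-quant-arm-1-g41/Q-ALONE-G41.md` §4b.  Complements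
`…QTwinClosed` (top ≤ t heavy/closed) and `…QTopOpen` (top > t heavy): with it, the twin-closed sub-cells of classes `mm`/`mM` are complete.

THE CELL.  Frame of the node; `1 ≤ k₁ ≤ j`, `2k₁ < t`, twin `P = k₁ + a ≤ j`, `P ≤ t`, `t ≤ 2P` (a mid closed to the zero; closed OR open to `k₁`), top
`K = k₂ ≤ j` with `t < k₁ + K` and LIGHT for `k₁`: `W := t − 2k₁ < y(K − k₁)` (gate `γ = y² + (1−y)W/(K−k₁)`, `usage = γ/(1−γ)`), `G = k₂ + a ≥ j+1`.
Then `Q` is `DECAtT y t j (M+a)` (`mixLawQ_decAtT_lightTop`).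
PROOF.  If `W ≤ ag` the (open) twin absorbs `k₁` (`pairGate ≤ g`; `…of_midsAbsorb`).  Else `2k₁ < S` and the twin is closed (`capP = 0`) or heavy and
saturated (`usage·capP = B`); either `k₁`'s rest fits into the top (`…of_midsAbsorb`) or the top is saturated too (`capK = C(1−γ)/γ`) and the rest rides the
giant, the offer inequality being `mixLawQ_offer_of_surplus` with `S_P = t·capP + (t−P)B ≥ 0` and `S_K = C(t/γ − K) ≥ k₁·A` (`mixLawQ_surplus_light_ge`
from **`S·γ ≤ (1−z)λt`** = `mixLawQ_light_gate` below, which needs exactly TA `y·k₂ ≤ S`, the light condition and `2k₁ ≤ S`).  Exact census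
(`work/explore/qlight4.py`): `S·γ ≤ (1−z)λt` holds in every light-top instance with `W > ag` (mm 19 565, mM 44 337, MM 8 696, Lm/LM 17 353 / 0).
HONEST STATUS: classes Mm/MM (twin above t), the k₂-low classes and cell QH remain (memo §4(iv)/§4b); `GatedSliceMixLaw'` (regime R), CW,
`GateMove`, `GatedConvEmptyFree`, `SingleGateConvClosed`, `TreeDEC`, `FarTreeRow` OPEN; RATE class log\* / honest sentence unchanged.

* `LawDec.mixLawQ_light_gate` — `2k₁ ≤ S`, TA, light ⟹ `S·γ ≤ (1−z)λt`.
* **`LawDec.mixLawQ_decAtT_lightTop`**, `LawDec.gatedSliceMixLaw'_lightTop`.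

[this work]; node: prim-quant-stmt g29/g30 (this lane).  Nothing here is cited as a published result.  The gluing rows served
[cite: KozmaNitzan2024, Conjecture 3 (p. 15)]; product measure [cite: Grimmett1999, §1.3 p. 10].
-/

noncomputable section

namespace Summit.CriticalPhenomena.PercolationContinuityZ3.Theorems

namespace Quant

open Finset

/-- the two-point law `{lo, hi; g}` (as in `…QuantLawDEC`) -/
local notation3 "TP[" lo ", " hi ", " g ", " h "]" =>
  (g : ℝ) * (if (h : ℕ) = (hi : ℕ) then (1 : ℝ) else 0) + (1 - (g : ℝ)) * (if (h : ℕ) = (lo : ℕ) then (1 : ℝ) else 0)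

namespace LawDec

/-- **light top: `S·γ ≤ (1−z)λt`** from `2k₁ ≤ S`, TA `yK ≤ S` and the light condition `W < y(K − k₁)` (`γ = y² + (1−y)W/(K−k₁)`): in the case
`(1−z)k₁ > Sy` one has `d = t − S < (2−y)k₁` and the quadratic slack `S k₁(z + (1−y)²)` dominates. [this work] -/
theorem mixLawQ_light_gate (z S t lam k₁ K a y g : ℝ) (hz0 : 0 ≤ z) (hz1 : z < 1) (hy0 : 0 < y) (hy1 : y < 1) (hg0 : 0 ≤ g)
    (hk₁0 : 0 ≤ k₁) (hkK : k₁ < K) (ha0 : 0 ≤ a) (hmean : (1 - z) * (k₁ + (K - k₁) * lam) = S) (ht : t = S + a * g * (1 - z))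
    (hTA : y * K ≤ S) (hlight : t - 2 * k₁ < y * (K - k₁)) (h2k : 2 * k₁ ≤ S) :
    S * (y ^ 2 + (1 - y) * ((t - 2 * k₁) / (K - k₁))) ≤ (1 - z) * lam * t := by
  have hd : 0 < K - k₁ := by linarith
  have h1z : 0 < 1 - z := by linarith
  set d := a * g * (1 - z) with hd_def
  have hd0 : 0 ≤ d := mul_nonneg (mul_nonneg ha0 hg0) h1z.le
  have hS0 : 0 ≤ S := by linarith
  have key : S * (y ^ 2 * (K - k₁) + (1 - y) * (t - 2 * k₁)) ≤ (1 - z) * lam * t * (K - k₁) := by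
    have e1 : (1 - z) * lam * t * (K - k₁) = t * (S - (1 - z) * k₁) := by
      have : (1 - z) * ((K - k₁) * lam) = S - (1 - z) * k₁ := by linarith [hmean]
      linear_combination t * this
    rw [e1]
    have hta2 : y ^ 2 * (K - k₁) ≤ y * (S - y * k₁) := by nlinarith
    have h2 : S * (y ^ 2 * (K - k₁) + (1 - y) * (t - 2 * k₁)) ≤ S * (y * (S - y * k₁) + (1 - y) * (t - 2 * k₁)) := by
      apply mul_le_mul_of_nonneg_left _ hS0; linarith
    refine h2.trans ?_
    rw [ht]
    have e3 : (S + d) * (S - (1 - z) * k₁) - S * (y * (S - y * k₁) + (1 - y) * (S + d - 2 * k₁))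
        = S * k₁ * (z + (1 - y) ^ 2) - d * (k₁ * (1 - z) - S * y) := by ring
    have h5 : 0 ≤ S * k₁ * (z + (1 - y) ^ 2) := mul_nonneg (mul_nonneg hS0 hk₁0) (by nlinarith [sq_nonneg (1 - y)])
    by_cases hk : k₁ * (1 - z) ≤ S * y
    · have : d * (k₁ * (1 - z) - S * y) ≤ 0 := mul_nonpos_of_nonneg_of_nonpos hd0 (by linarith)
      linarith [e3]
    · have hX : 0 ≤ k₁ * (1 - z) - S * y := by linarith [not_le.1 hk]
      have hl : d < (2 - y) * k₁ := by
        have : y * (K - k₁) ≤ S - y * k₁ := by linarith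
        rw [ht] at hlight; linarith
      have h3 := mul_le_mul_of_nonneg_right hl.le hX
      have h4 : 0 ≤ k₁ * (S - 2 * k₁) := mul_nonneg hk₁0 (by linarith)
      have h6 : (2 - y) * k₁ * (k₁ * (1 - z) - S * y) ≤ S * k₁ * (z + (1 - y) ^ 2) := by
        have e4 : S * k₁ * (z + (1 - y) ^ 2) - (2 - y) * k₁ * (k₁ * (1 - z) - S * y)
            = k₁ * (S - 2 * k₁) + k₁ * S * z + k₁ * k₁ * (2 * z + y * (1 - z)) := by ring
        nlinarith [e4, h4, mul_nonneg (mul_nonneg hk₁0 hS0) hz0, mul_nonneg (mul_nonneg hk₁0 hk₁0) (by nlinarith : (0:ℝ) ≤ 2 * z + y * (1 - z))]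
      linarith [e3, h3, h5, h6]
  have e2 : S * (y ^ 2 + (1 - y) * ((t - 2 * k₁) / (K - k₁))) * (K - k₁) = S * (y ^ 2 * (K - k₁) + (1 - y) * (t - 2 * k₁)) := by
    field_simp
  refine le_of_mul_le_mul_right ?_ hd
  rw [e2]; exact key

set_option maxHeartbeats 800000 in
/-- **LIGHT TOP (twin a mid at or below `t`, closed or open to `k₁`) ⟹ `Q` IS DEC.**  See the file header. [this work] -/
theorem mixLawQ_decAtT_lightTop (y z g S lam : ℝ) (a j M k₁ k₂ : ℕ)
    (hy0 : 0 < y) (hy1 : y < 1) (hz0 : 0 ≤ z) (hz1 : z < 1) (hg1 : g ≤ 1) (hyg : y ≤ (1 - z) * g) (ha : 1 ≤ a)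
    (hta : y * (M : ℝ) ≤ S) (hk : k₁ ≤ k₂) (hk₂M : k₂ ≤ M) (hlam0 : 0 ≤ lam) (hlam1 : lam ≤ 1)
    (hmean : (1 - z) * ((k₁ : ℝ) + ((k₂ : ℝ) - k₁) * lam) = S)
    (hk₁ : 1 ≤ k₁) (hk₁j : k₁ ≤ j) (hk₁low : 2 * (k₁ : ℝ) < S + (a : ℝ) * g * (1 - z))
    (hPj : k₁ + a ≤ j) (hPt : ((k₁ : ℝ) + a) ≤ S + (a : ℝ) * g * (1 - z)) (hPmid : S + (a : ℝ) * g * (1 - z) ≤ 2 * ((k₁ : ℝ) + a))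
    (hKj : k₂ ≤ j) (hKcomp : S + (a : ℝ) * g * (1 - z) < (k₁ : ℝ) + k₂)
    (hKlight : S + (a : ℝ) * g * (1 - z) - 2 * (k₁ : ℝ) < y * ((k₂ : ℝ) - k₁))
    (hG : j + 1 ≤ k₂ + a) :
    DECAtT y (S + (a : ℝ) * g * (1 - z)) j (M + a)
      (fun p => z * (if p = 0 then (1 : ℝ) else 0) + (1 - z) * slice (fun q => TP[k₁, k₂, lam, q]) a g p) := by
  set t : ℝ := S + (a : ℝ) * g * (1 - z) with ht
  set A : ℝ := (1 - z) * (1 - lam) * (1 - g) with hA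
  set B : ℝ := (1 - z) * (1 - lam) * g with hB
  set C : ℝ := (1 - z) * lam * (1 - g) with hC
  set D : ℝ := (1 - z) * lam * g with hD
  have hg0 : 0 < g := by
    by_contra hc
    have : (1 - z) * g ≤ 0 := mul_nonpos_of_nonneg_of_nonpos (by linarith) (not_lt.1 hc)
    linarith
  have h1z : 0 < 1 - z := by linarith
  have h1y : 0 < 1 - y := by linarith
  have hA0 : 0 ≤ A := mul_nonneg (mul_nonneg h1z.le (by linarith)) (by linarith)
  have hB0 : 0 ≤ B := mul_nonneg (mul_nonneg h1z.le (by linarith)) hg0.le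
  have hC0 : 0 ≤ C := mul_nonneg (mul_nonneg h1z.le hlam0) (by linarith)
  have hD0 : 0 ≤ D := mul_nonneg (mul_nonneg h1z.le hlam0) hg0.le
  have ha1 : (1 : ℝ) ≤ a := by exact_mod_cast ha
  have hk₁r : (1 : ℝ) ≤ k₁ := by exact_mod_cast hk₁
  have hkr : (k₁ : ℝ) ≤ k₂ := by exact_mod_cast hk
  have ht0 : 0 < t := by linarith
  have hPr : ((k₁ + a : ℕ) : ℝ) = (k₁ : ℝ) + a := by push_cast; ring
  have hk₁k₂ : (k₁ : ℝ) < k₂ := by linarith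
  have hPmid' : t ≤ 2 * ((k₁ + a : ℕ) : ℝ) := by rw [hPr]; exact hPmid
  have hKmid : t ≤ 2 * (k₂ : ℝ) := by linarith
  -- mass and mean (pure algebra)
  have hmass : z + A + B + C + D = 1 := by rw [hA, hB, hC, hD]; ring
  have hmom : (k₁ : ℝ) * A + ((k₁ : ℝ) + a) * B + (k₂ : ℝ) * C + ((k₂ : ℝ) + a) * D = t := by
    rw [hA, hB, hC, hD, ht, ← hmean]; ring
  have htz : t * z = -((t - k₁) * A) - (t - ((k₁ : ℝ) + a)) * B - (t - k₂) * C + ((k₂ : ℝ) + a - t) * D := by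
    have e1 : t * z = t * (1 - A - B - C - D) := by rw [← hmass]; ring
    rw [e1]; linarith [hmom]
  have hyK : y * (k₂ : ℝ) ≤ S := (mul_le_mul_of_nonneg_left (by exact_mod_cast hk₂M) hy0.le).trans hta
  have hyG : y * ((k₂ : ℝ) + a) ≤ t := by
    have h3 : y * (a : ℝ) ≤ (a : ℝ) * g * (1 - z) := by
      calc y * (a : ℝ) ≤ (1 - z) * g * (a : ℝ) := mul_le_mul_of_nonneg_right hyg (Nat.cast_nonneg a)
        _ = (a : ℝ) * g * (1 - z) := by ring
    have e : y * ((k₂ : ℝ) + a) = y * (k₂ : ℝ) + y * (a : ℝ) := by ring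
    rw [e, ht]; linarith
  have huG : usage y t j k₁ (k₂ + a) = y / (1 - y) := usage_giant_eq y t j k₁ (k₂ + a) hG
  have hcapG_of : ∀ xG : ℝ, y * (z + xG) ≤ (1 - y) * D → usage y t j k₁ (k₂ + a) * xG ≤ D := by
    intro xG hE
    rw [huG, div_mul_eq_mul_div, div_le_iff₀ h1y]
    have : y * xG ≤ y * (z + xG) := by nlinarith
    linarith [mul_comm (1 - y) D]
  -- the light top: `ρ = W/(K − k₁) < y`, gate `γ = y² + (1−y)ρ`
  set W : ℝ := t - 2 * (k₁ : ℝ) with hWdef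
  have hW0 : 0 < W := by rw [hWdef]; linarith
  set ρ : ℝ := W / ((k₂ : ℝ) - k₁) with hρ
  have hd : (0 : ℝ) < (k₂ : ℝ) - k₁ := by linarith
  have hρ0 : 0 < ρ := div_pos hW0 hd
  have hρy : ρ < y := by rw [hρ, div_lt_iff₀ hd]; exact hKlight
  set γ : ℝ := y ^ 2 + (1 - y) * ρ with hγ
  have hγ0 : 0 < γ := by
    have h1 : 0 < (1 - y) * ρ := mul_pos h1y hρ0
    have h2 : 0 ≤ y ^ 2 := sq_nonneg y
    rw [hγ]; linarith
  have hγ1 : γ < 1 := by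
    have h1 := mul_lt_mul_of_pos_left hρy h1y
    have e : y ^ 2 + (1 - y) * y = y := by ring
    rw [hγ]; linarith
  have hKng : ¬ (j + 1 ≤ k₂) := by omega
  have huK : usage y t j k₁ k₂ = γ / (1 - γ) := by
    have hmax : ρ ≤ y ^ 2 + (1 - y) * ρ := by
      have h1 := mul_le_mul_of_nonneg_left hρy.le hy0.le
      have e1 : y ^ 2 = y * y := sq y
      have e2 : (1 - y) * ρ = ρ - y * ρ := by ring
      linarith
    simp only [usage, gateOf, if_neg hKng, pairGate]
    rw [← hWdef, ← hρ, max_eq_right hmax]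
  set capK : ℝ := C * (1 - γ) / γ with hcapK
  have hcapK0 : 0 ≤ capK := div_nonneg (mul_nonneg hC0 (sub_nonneg.2 hγ1.le)) hγ0.le
  have hγne : 1 - γ ≠ 0 := ne_of_gt (by linarith)
  have hγne0 : γ ≠ 0 := ne_of_gt hγ0
  have hsatK : usage y t j k₁ k₂ * capK = C := by
    rw [huK, hcapK, div_mul_div_comm, mul_comm (1 - γ) γ, ← mul_assoc]
    rw [mul_div_mul_right _ _ hγne, mul_comm γ C, mul_div_assoc, div_self hγne0, mul_one]
  have huK0 : 0 ≤ usage y t j k₁ k₂ := by rw [huK]; exact div_nonneg hγ0.le (by linarith)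
  have hPng : ¬ (j + 1 ≤ k₁ + a) := by omega
  have hPabs : t ≤ 2 * ((k₁ + a : ℕ) : ℝ) ∨ j < k₁ + a := Or.inl hPmid'
  have hKabs : t ≤ 2 * (k₂ : ℝ) ∨ j < k₂ := Or.inl hKmid
  -- a generic finishing step: given the twin's shipped amount `xP` with `usage·xP = B` OR `xP = 0`, the top saturated, the offer holds
  have hmeanK : (1 - z) * lam * (k₂ : ℝ) = S - (1 - z) * k₁ + (1 - z) * lam * k₁ := by rw [← hmean]; ring
  have hSKeq : t * capK + (t - (k₂ : ℝ)) * C = ((1 - z) * lam * (1 - g)) * (t / γ - k₂) := by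
    rw [hcapK, hC]; field_simp; ring
  -- the light surplus pays `k₁`'s whole deficit as soon as `2k₁ ≤ S`
  have hSK_of : 2 * (k₁ : ℝ) ≤ S → (k₁ : ℝ) * A ≤ t * capK + (t - (k₂ : ℝ)) * C := by
    intro h2k
    have hL := mixLawQ_light_gate z S t lam (k₁ : ℝ) (k₂ : ℝ) (a : ℝ) y g hz0 hz1 hy0 hy1 hg0.le (by linarith) hk₁k₂ (by linarith)
      hmean ht hyK hKlight h2k
    have hL' : S * γ ≤ (1 - z) * lam * t := by rw [hγ, hρ, hWdef]; exact hL
    have hSK := mixLawQ_surplus_light_ge z S t lam (k₁ : ℝ) (k₂ : ℝ) g γ hg1 hγ0 hL' hmeanK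
    rw [hSKeq, hA]; exact hSK
  -- the giant-term form of the offer target from `hE`
  have hfinal : ∀ xG : ℝ, y * (z + xG) ≤ (1 - y) * D →
      t * z ≤ t * (1 - y) / y * (D - usage y t j k₁ (k₂ + a) * xG) := by
    intro xG hE
    rw [huG]
    have hz : z ≤ (1 - y) / y * D - xG := by
      rw [div_mul_eq_mul_div, le_sub_iff_add_le, le_div_iff₀ hy0]
      linarith [hE, mul_comm y (z + xG)]
    have e : t * (1 - y) / y * (D - y / (1 - y) * xG) = t * ((1 - y) / y * D - xG) := by
      have hy0' : y ≠ 0 := ne_of_gt hy0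
      have h1y' : 1 - y ≠ 0 := ne_of_gt h1y
      field_simp
    rw [e]
    exact mul_le_mul_of_nonneg_left hz ht0.le
  by_cases hPc : t < 2 * (k₁ : ℝ) + a
  · -- the twin is OPEN to `k₁`
    have hWa : W < a := by rw [hWdef]; linarith
    have ha0 : (0 : ℝ) < a := by linarith
    have hPcomp : t < (k₁ : ℝ) + ((k₁ + a : ℕ) : ℝ) := by rw [hPr]; linarith
    have hρP : (t - 2 * (k₁ : ℝ)) / (((k₁ + a : ℕ) : ℝ) - k₁) = W / a := by rw [hPr, hWdef]; ring_nf
    have hyg' : y ≤ g := by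
      have := mul_le_of_le_one_left hg0.le (show 1 - z ≤ 1 by linarith)
      linarith
    by_cases hWg : W ≤ (a : ℝ) * g
    · -- the twin absorbs `k₁` entirely
      have hpg : pairGate y t k₁ (k₁ + a) ≤ g := by
        simp only [pairGate]
        rw [hρP]
        have h1 : W / a ≤ g := by rw [div_le_iff₀ ha0]; linarith
        refine max_le h1 ?_
        have h2 : (1 - y) * (W / a) ≤ (1 - y) * g := mul_le_mul_of_nonneg_left h1 h1y.le
        have h3 : y ^ 2 ≤ y * g := by rw [sq]; exact mul_le_mul_of_nonneg_left hyg' hy0.le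
        linarith
      have hpg1 : pairGate y t k₁ (k₁ + a) < 1 := pairGate_lt_one y t k₁ (k₁ + a) hy0 hy1 hk₁low hPcomp
      have huse : usage y t j k₁ (k₁ + a) * A ≤ B := by
        have eU : usage y t j k₁ (k₁ + a) = pairGate y t k₁ (k₁ + a) / (1 - pairGate y t k₁ (k₁ + a)) := by
          simp only [usage, gateOf, if_neg hPng]
        rw [eU, div_mul_eq_mul_div, div_le_iff₀ (by linarith)]
        rw [hA, hB]
        have h1g : 0 ≤ (1 - z) * (1 - lam) := mul_nonneg h1z.le (by linarith)
        have h := mul_le_mul_of_nonneg_left hpg h1g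
        have e1 : pairGate y t k₁ (k₁ + a) * ((1 - z) * (1 - lam) * (1 - g))
            = (1 - z) * (1 - lam) * pairGate y t k₁ (k₁ + a) - ((1 - z) * (1 - lam) * pairGate y t k₁ (k₁ + a)) * g := by ring
        have e2 : (1 - z) * (1 - lam) * g * (1 - pairGate y t k₁ (k₁ + a))
            = (1 - z) * (1 - lam) * g - ((1 - z) * (1 - lam) * pairGate y t k₁ (k₁ + a)) * g := by ring
        rw [e1, e2]
        linarith [h]
      exact mixLawQ_decAtT_of_midsAbsorb y z g S lam a j M k₁ k₂ A 0 hy0 hy1 hz0 hz1 hg1 hyg ha hta hk hk₂M hlam0 hlam1 hmean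
        hk₁ hk₁j hk₁low hPabs hKabs hG hA0 le_rfl (by ring) (fun _ => ⟨hPj, hPcomp⟩) (fun h => absurd h (lt_irrefl _))
        huse (by rw [mul_zero]; exact hC0)
    · -- the twin is heavy and saturated; then `2k₁ < S`
      have hWg' : (a : ℝ) * g < W := not_le.1 hWg
      have h2k : 2 * (k₁ : ℝ) ≤ S := by
        have h0 : 0 ≤ (a : ℝ) * g * z := mul_nonneg (mul_nonneg ha0.le hg0.le) hz0
        have h1 : (a : ℝ) * g < t - 2 * (k₁ : ℝ) := hWg'
        have e : (a : ℝ) * g * (1 - z) = a * g - a * g * z := by ring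
        linarith [h1, ht, e, h0]
      have hρP1 : W / a < 1 := by rw [div_lt_one ha0]; exact hWa
      have hρP0 : 0 < W / a := div_pos hW0 ha0
      have hyρP : y ≤ W / a := by
        rw [le_div_iff₀ ha0]
        have h1 : y * (a : ℝ) ≤ g * a := mul_le_mul_of_nonneg_right hyg' ha0.le
        have h2 : g * (a : ℝ) = a * g := mul_comm _ _
        linarith
      have huP : usage y t j k₁ (k₁ + a) = (W / a) / (1 - W / a) := by
        have hmax : y ^ 2 + (1 - y) * (W / a) ≤ W / a := by
          have h := mul_nonpos_of_nonneg_of_nonpos hy0.le (sub_nonpos.2 hyρP)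
          have e : y ^ 2 + (1 - y) * (W / a) = W / a + y * (y - W / a) := by ring
          rw [e]; linarith
        simp only [usage, gateOf, if_neg hPng, pairGate]
        rw [hρP, max_eq_left hmax]
      set capP : ℝ := B * (1 - W / a) / (W / a) with hcapPdef
      have hcapP0 : 0 ≤ capP := div_nonneg (mul_nonneg hB0 (by linarith)) hρP0.le
      have hsatP : usage y t j k₁ (k₁ + a) * capP = B := by
        have h1 : 1 - W / a ≠ 0 := ne_of_gt (by linarith)
        have h2 : W / a ≠ 0 := ne_of_gt hρP0
        rw [huP, hcapPdef, div_mul_div_comm, mul_comm (1 - W / a) (W / a), ← mul_assoc]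
        rw [mul_div_mul_right _ _ h1, mul_comm (W / a) B, mul_div_assoc, div_self h2, mul_one]
      by_cases hfitK : A - capP ≤ capK
      · have huseK : usage y t j k₁ k₂ * (A - capP) ≤ C := by
          have := mul_le_mul_of_nonneg_left hfitK huK0
          linarith [hsatK]
        by_cases hAP : A ≤ capP
        · -- even the twin alone absorbs `k₁`
          have huseP : usage y t j k₁ (k₁ + a) * A ≤ B := by
            have huP0 : 0 ≤ usage y t j k₁ (k₁ + a) := by rw [huP]; exact div_nonneg hρP0.le (by linarith)
            have := mul_le_mul_of_nonneg_left hAP huP0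
            linarith [hsatP]
          exact mixLawQ_decAtT_of_midsAbsorb y z g S lam a j M k₁ k₂ A 0 hy0 hy1 hz0 hz1 hg1 hyg ha hta hk hk₂M hlam0 hlam1 hmean
            hk₁ hk₁j hk₁low hPabs hKabs hG hA0 le_rfl (by ring) (fun _ => ⟨hPj, hPcomp⟩) (fun h => absurd h (lt_irrefl _))
            huseP (by rw [mul_zero]; exact hC0)
        · exact mixLawQ_decAtT_of_midsAbsorb y z g S lam a j M k₁ k₂ capP (A - capP) hy0 hy1 hz0 hz1 hg1 hyg ha hta hk hk₂M hlam0 hlam1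
            hmean hk₁ hk₁j hk₁low hPabs hKabs hG hcapP0 (by linarith [not_le.1 hAP]) (by ring) (fun _ => ⟨hPj, hPcomp⟩)
            (fun _ => ⟨hKj, hKcomp⟩) (le_of_eq hsatP) huseK
      · -- both saturated
        have hxG0 : 0 ≤ A - capP - capK := by linarith [not_le.1 hfitK]
        have hE : y * (z + (A - capP - capK)) ≤ (1 - y) * D := by
          refine mixLawQ_offer_of_surplus t y k₁ k₂ a A B C D z capP capK (t * capP + (t - ((k₁ : ℝ) + a)) * B)
            (t * capK + (t - (k₂ : ℝ)) * C) hy0 ht0 htz hyG hD0 rfl rfl ?_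
          have hSP0 : 0 ≤ t * capP + (t - ((k₁ : ℝ) + a)) * B := add_nonneg (mul_nonneg ht0.le hcapP0) (mul_nonneg (by linarith) hB0)
          linarith [hSK_of h2k]
        refine mixLawQ_decAtT_of_routing y z g S lam a j M k₁ k₂ capP capK (A - capP - capK) hy0 hy1 hz0 hz1 hg1 hyg ha hta hk hk₂M
          hlam0 hlam1 hmean hk₁ hk₁j hk₁low hPabs hKabs hG hcapP0 hcapK0 hxG0 (by ring)
          (fun _ => Or.inr hPcomp) (fun _ => Or.inr hKcomp) (le_of_eq hsatP) (le_of_eq hsatK) (hcapG_of _ hE) ?_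
        rw [hsatP, sub_self, mul_zero, hsatK, sub_self, mul_zero, zero_add, zero_add]
        exact hfinal _ hE
  · -- the twin is CLOSED to `k₁`; then `2k₁ ≤ S`
    have hPc' : 2 * (k₁ : ℝ) + a ≤ t := not_lt.1 hPc
    have h2k : 2 * (k₁ : ℝ) ≤ S := by
      have hg1z : g * (1 - z) ≤ 1 := by
        have := mul_le_of_le_one_right hg0.le (by linarith : 1 - z ≤ 1)
        linarith
      have h3 : (a : ℝ) * g * (1 - z) ≤ a := by
        have := mul_le_mul_of_nonneg_left hg1z (by linarith : (0:ℝ) ≤ a)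
        linarith [show (a : ℝ) * g * (1 - z) = a * (g * (1 - z)) by ring]
      have h4 : 2 * (k₁ : ℝ) + a ≤ t := hPc'
      linarith [h4, ht, h3]
    by_cases hfitK : A ≤ capK
    · have huseK : usage y t j k₁ k₂ * A ≤ C := by
        have := mul_le_mul_of_nonneg_left hfitK huK0
        linarith [hsatK]
      exact mixLawQ_decAtT_of_midsAbsorb y z g S lam a j M k₁ k₂ 0 A hy0 hy1 hz0 hz1 hg1 hyg ha hta hk hk₂M hlam0 hlam1 hmean
        hk₁ hk₁j hk₁low hPabs hKabs hG le_rfl hA0 (by ring) (fun h => absurd h (lt_irrefl _)) (fun _ => ⟨hKj, hKcomp⟩)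
        (by rw [mul_zero]; exact hB0) huseK
    · have hE : y * (z + (A - 0 - capK)) ≤ (1 - y) * D := by
        refine mixLawQ_offer_of_surplus t y k₁ k₂ a A B C D z 0 capK ((t - ((k₁ : ℝ) + a)) * B) (t * capK + (t - (k₂ : ℝ)) * C)
          hy0 ht0 htz hyG hD0 (by ring) rfl ?_
        have hSP0 : 0 ≤ (t - ((k₁ : ℝ) + a)) * B := mul_nonneg (by linarith) hB0
        linarith [hSK_of h2k]
      rw [sub_zero] at hE
      refine mixLawQ_decAtT_of_routing y z g S lam a j M k₁ k₂ 0 capK (A - capK) hy0 hy1 hz0 hz1 hg1 hyg ha hta hk hk₂M hlam0 hlam1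
        hmean hk₁ hk₁j hk₁low hPabs hKabs hG le_rfl hcapK0 (by linarith [not_le.1 hfitK]) (by ring)
        (fun h => absurd h (lt_irrefl _)) (fun _ => Or.inr hKcomp) (by rw [mul_zero]; exact hB0) (le_of_eq hsatK) (hcapG_of _ hE) ?_
      rw [if_neg hPng, hPr, if_neg (by linarith : ¬ (t < (k₁ : ℝ) + a)), zero_mul, zero_add, hsatK, sub_self, mul_zero, zero_add]
      exact hfinal _ hE

/-- **`GatedSliceMixLaw'` with θ = 0 in the light-top cell.** [this work] -/
theorem gatedSliceMixLaw'_lightTop (y z g S lam : ℝ) (a j M h k₁ k₂ : ℕ)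
    (hy0 : 0 < y) (hy1 : y < 1) (hz0 : 0 ≤ z) (hz1 : z < 1) (hg1 : g ≤ 1) (hyg : y ≤ (1 - z) * g) (ha : 1 ≤ a)
    (hta : y * (M : ℝ) ≤ S) (hk : k₁ ≤ k₂) (hk₂M : k₂ ≤ M) (hlam0 : 0 ≤ lam) (hlam1 : lam ≤ 1)
    (hmean : (1 - z) * ((k₁ : ℝ) + ((k₂ : ℝ) - k₁) * lam) = S)
    (hk₁ : 1 ≤ k₁) (hk₁j : k₁ ≤ j) (hk₁low : 2 * (k₁ : ℝ) < S + (a : ℝ) * g * (1 - z))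
    (hPj : k₁ + a ≤ j) (hPt : ((k₁ : ℝ) + a) ≤ S + (a : ℝ) * g * (1 - z)) (hPmid : S + (a : ℝ) * g * (1 - z) ≤ 2 * ((k₁ : ℝ) + a))
    (hKj : k₂ ≤ j) (hKcomp : S + (a : ℝ) * g * (1 - z) < (k₁ : ℝ) + k₂)
    (hKlight : S + (a : ℝ) * g * (1 - z) - 2 * (k₁ : ℝ) < y * ((k₂ : ℝ) - k₁))
    (hG : j + 1 ≤ k₂ + a) :
    ∃ θ : ℝ, 0 ≤ θ ∧ θ < 1 ∧
      DECAtT y (S + (a : ℝ) * g * (1 - z)) j (M + a)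
        (fun p => θ * weakMidLaw S g h a p
          + (1 - θ) * (z * (if p = 0 then (1 : ℝ) else 0) + (1 - z) * slice (fun q => TP[k₁, k₂, lam, q]) a g p)) := by
  refine ⟨0, le_rfl, zero_lt_one, ?_⟩
  refine decAtT_congr (fun p => ?_)
    (mixLawQ_decAtT_lightTop y z g S lam a j M k₁ k₂ hy0 hy1 hz0 hz1 hg1 hyg ha hta hk hk₂M hlam0 hlam1 hmean hk₁ hk₁j hk₁low hPj hPt
      hPmid hKj hKcomp hKlight hG)
  ring

end LawDec

end Quant

end Summit.CriticalPhenomena.PercolationContinuityZ3.Theorems
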